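import Mathlib.RepresentationTheory.Basic
import Mathlib.LinearAlgebra.Span.Basic
import HarnessLib

/-!
# Barrier: monodromy preserves the quantum product, so quantum-generated classes from invariant seeds are monodromy-invariant

Barrier catalogue `Literature/Barriers/HodgeConjecture` (D-0021); technique class
`quantum-cohomology`, `gromov-witten-correspondences`, `deformation-invariant-correspondences`,
`regular-element-criterion`. Sources read:

* S. Galkin, N. C. Leung, C. Li, R. Xiong, *A-D-E diagrams, Hodge–Tate hyperplane sections and
  semisimple quantum cohomology*, arXiv:2509.01101 (2025) [GalkinLeungLiXiong2025], §3.3, p. 14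
  (materialised text `paper:arxiv-2509.01101` p0014): "Let `π : 𝒴 → U` be a projective smooth
  morphism. Let `p ∈ U` be any point and denote `𝒴_p := π⁻¹(p)` … There is a monodromy action
  ([Voisin]) of the fundamental group `π₁(U,p)` on the classical cohomology `H^*(𝒴_p)`.
  **Proposition 3.20** ([LiTi], see also [Hu15]). *The monodromy action of `π₁(U,p)` on `H^*(𝒴_p)`
  naturally extends to an action on `QH^*(𝒴_p)` and preserves the quantum product.*"; §1 p. 5:
  "The fundamental group of the smooth locus acts on `H^*(Y)` by monodromy, and preserves the
  quantum product"; §4.2, Lemma 4.3 (for a smooth hyperplane section `Y` of a coadjoint `G/P` of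
  type `D` or `E`, realised as a fibre over the regular semisimple locus: "The monodromy action
  factors through the Weyl group `W`, and as a `W`-representation `H^*(Y) = H^*(Y)_inv ⊕ H^*(Y)_std`
  with `H^*(Y)_std ≅ 𝔥_std` the reflection representation"), Lemma 4.4 (`(Sym^d 𝔥_std)^W` starts in
  degrees `d₁ = 2 < 4 ≤ d₂` except in type `A`, Chevalley), Thm. 4.5 (proof: "By Proposition 3.20,
  the symmetric cubic form `(γ₁ ⋆_{q=1} γ₂, γ₃)_Y` … is `W`-invariant", hence vanishes on `H_std`).
* J. Li, G. Tian, JAMS 11 (1998) [LiTian1998] (virtual cycles; deformation invariance of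
  Gromov–Witten invariants in smooth projective families) and X. Hu, arXiv:1501.03683 [Hu2015]
  (monodromy method for big quantum cohomology of complete intersections) — the references of
  Prop. 3.20.

## What is vendored, and what is proved

The *geometric* statement (Prop. 3.20) needs Gromov–Witten invariants / quantum cohomology, which
neither Mathlib nor the tree has (`lean search 'quantum|GromovWitten'` in declarations: nothing);
a hypothesis structure merely *naming* a product on `H^*(𝒴_p)` would make a "named fact" about it
unfalsifiable. What the Hodge programme uses is the COROLLARY, whose content beyond Prop. 3.20 is
pure algebra, and that we PROVE in full generality (`isFixed_of_mem_seedGenerated`): if a monoid `G`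
acts linearly on a module `A` (`Representation`), a family of bilinear operations
`m t : A → A → A` (`t ∈ T`: e.g. the classical cup product, the small quantum products `⋆_q` after
fixing Novikov variables, the big quantum products `⋆_τ` at *invariant* parameters `τ`) is
`G`-equivariant, and a set of **seeds** `Σ ⊆ A` is pointwise fixed (e.g. restrictions of ambient
classes — Deligne's invariant cycle theorem, in tree as
`Literature.AlgebraicGeometry.Motives.GeometricVHSData.monodromyRep_restrict` — or Chern classes of
the fibres of bundles defined on the total space), then EVERY element of the submodule generated
from `Σ` by the operations (`seedGenerated m Σ`, the technique class made explicit) is fixed by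
`G`. Consequently a class certified algebraic by any "quantum generation from algebraic seeds"
mechanism (the retired cards `quantum-regular-algebraicity`, `quantum-regularity-spectral-
algebraicity`: "if some algebraic `a` has a `⋆`-multiplication operator with simple spectrum then
`Alg(X) = H^ev(X)`") is invariant under the monodromy of every smooth projective family through
`X` in which the seeds stay algebraic and invariant — i.e. it is a *generic* Hodge class over that
locus, never a Noether–Lefschetz-special one; and on Hodge–Tate hyperplane sections of coadjoint
`G/P` of type `D`/`E`, where monodromy acts on `H_van = H_std` through the reflection
representation of `W(D/E)`, invariant operators are scalar on `H_std` (Schur) and the invariant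
symmetric cubic GW form vanishes there (GLLX Lemma 4.3–4.4, Thm. 4.5), so quantum multiplication
by invariant classes cannot even separate vanishing classes.

No named fact is introduced (D-0026): the barrier is the proved theorem; Prop. 3.20 is quoted as
its `because:`.

## References

* [GalkinLeungLiXiong2025] arXiv:2509.01101, Prop. 3.20 (p. 14), Lemma 4.3, Lemma 4.4, Thm. 4.5
  (pp. 16–17).
* [LiTian1998] J. Li, G. Tian, JAMS 11 (1998) 119–174.
* [Hu2015] X. Hu, arXiv:1501.03683.
-/

namespace Literature.Barriers.HodgeConjecture

section Barriers
section HodgeConjecture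

variable {R : Type*} [CommSemiring R] {A : Type*} [AddCommMonoid A] [Module R A] {T : Type*}

/-! ### The technique class: classes generated from seeds by a family of bilinear products -/

/-- A submodule `N ⊆ A` is **closed under the operations** `m t` (`t ∈ T`) if
`m t a b ∈ N` for all `a, b ∈ N`. [folklore] -/
def IsClosedUnderOps (m : T → A →ₗ[R] A →ₗ[R] A) (N : Submodule R A) : Prop :=
  ∀ t : T, ∀ a ∈ N, ∀ b ∈ N, m t a b ∈ N

/-- **Technique class `seed-generated classes`**: the smallest submodule of `A` containing the
seed set `Σ` and closed under all the bilinear operations `m t`, `t ∈ T` — for `A = H^*(X) ⊗ Λ`,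
`Σ` = algebraic seed classes (ambient restrictions, Chern classes) and `m` = the classical and
(small/big, at seed-valued parameters) quantum products, this is the module of classes reachable by
"quantum generation from algebraic seeds" (the mechanism of the retired Hodge cards
`quantum-regular-algebraicity` / `quantum-regularity-spectral-algebraicity`). Defined as an
infimum over all closed submodules containing `Σ`. [folklore] -/
def seedGenerated (m : T → A →ₗ[R] A →ₗ[R] A) (seeds : Set A) : Submodule R A :=
  sInf {N : Submodule R A | seeds ⊆ N ∧ IsClosedUnderOps m N}

/-- The seeds lie in the seed-generated submodule. [folklore] -/
theorem subset_seedGenerated (m : T → A →ₗ[R] A →ₗ[R] A) (seeds : Set A) :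
    seeds ⊆ seedGenerated m seeds := by
  intro s hs
  refine (Submodule.mem_sInf).mpr fun N hN => hN.1 hs

/-- The seed-generated submodule is closed under the operations. [folklore] -/
theorem isClosedUnderOps_seedGenerated (m : T → A →ₗ[R] A →ₗ[R] A) (seeds : Set A) :
    IsClosedUnderOps m (seedGenerated m seeds) := by
  intro t a ha b hb
  refine (Submodule.mem_sInf).mpr fun N hN => ?_
  exact hN.2 t a ((Submodule.mem_sInf).mp ha N hN) b ((Submodule.mem_sInf).mp hb N hN)

/-- **Minimality / induction principle**: any submodule containing the seeds and closed under the
operations contains every seed-generated class. [folklore] -/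
theorem seedGenerated_le {m : T → A →ₗ[R] A →ₗ[R] A} {seeds : Set A} {N : Submodule R A}
    (hseeds : seeds ⊆ N) (hN : IsClosedUnderOps m N) : seedGenerated m seeds ≤ N :=
  sInf_le ⟨hseeds, hN⟩

/-! ### The invariant submodule of a linear action -/

variable {G : Type*} [Monoid G]

/-- The submodule of `G`-fixed vectors of a linear action `ρ : G →* End_R(A)`
(`Representation R G A`): `{a | ∀ g, ρ g a = a}`. [folklore] -/
def fixedSubmodule (ρ : Representation R G A) : Submodule R A where
  carrier := {a | ∀ g : G, ρ g a = a}
  add_mem' {a b} ha hb g := by rw [map_add, ha g, hb g]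
  zero_mem' g := by rw [map_zero]
  smul_mem' c {a} ha g := by rw [map_smul, ha g]

/-- Membership in the fixed submodule (definitional). [folklore] -/
theorem mem_fixedSubmodule_iff {ρ : Representation R G A} {a : A} :
    a ∈ fixedSubmodule ρ ↔ ∀ g : G, ρ g a = a := Iff.rfl

/-- **Equivariant operations preserve the fixed submodule**: if `ρ g (m t a b) = m t (ρ g a) (ρ g b)`
for all `g, t, a, b`, then `m t` maps fixed vectors to fixed vectors. [folklore] -/
theorem isClosedUnderOps_fixedSubmodule {ρ : Representation R G A} {m : T → A →ₗ[R] A →ₗ[R] A}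
    (hm : ∀ (g : G) (t : T) (a b : A), ρ g (m t a b) = m t (ρ g a) (ρ g b)) :
    IsClosedUnderOps m (fixedSubmodule ρ) := by
  intro t a ha b hb g
  rw [hm, ha g, hb g]

/-! ### The barrier -/

/-- **Barrier — quantum-generated classes from invariant seeds are monodromy-invariant** (the
algebra behind Galkin–Leung–Li–Xiong 2025, Prop. 3.20 = Li–Tian 1998 / Hu 2015: "the monodromy
action of `π₁(U,p)` on `H^*(𝒴_p)` naturally extends to an action on `QH^*(𝒴_p)` and preserves the
quantum product", combined with Deligne's invariant cycle theorem), PROVED: let `G` act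
`R`-linearly on `A` (`ρ`), let the bilinear operations `m t` (`t ∈ T`) be `G`-equivariant, and let
every seed `s ∈ Σ` be `G`-fixed. Then every element of the seed-generated submodule
`seedGenerated m Σ` is `G`-fixed. [cite: GalkinLeungLiXiong2025, Prop. 3.20 (p. 14) with Lemma 4.3 and Thm. 4.5 (pp. 16–17)]

BARRIER (D-0021)
* technique_class: quantum-cohomology, gromov-witten-correspondences, deformation-invariant-correspondences, regular-element-criterion — formally `seedGenerated m Σ`: classes generated from a seed set by a family of equivariant bilinear products (cup product; small quantum products; big quantum products `⋆_τ` at invariant `τ`)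
* blocks: certifying algebraicity of Hodge classes (towards `HodgeConjecture`) through classes generated from monodromy-invariant algebraic seeds (restrictions of ambient classes, Chern classes) by quantum multiplication — in particular the "regular algebraic element" criterion of the retired cards quantum-regular-algebraicity / quantum-regularity-spectral-algebraicity ("some algebraic `a` has a `⋆`-operator with simple spectrum ⇒ `Alg(X) = H^ev(X)`"): such mechanisms only ever reach classes invariant under the monodromy of every smooth projective family in which the seeds stay invariant, i.e. generic Hodge classes over the seeds' algebraicity locus, never Noether–Lefschetz-special classes [cite: GalkinLeungLiXiong2025, Prop. 3.20 and Lemma 3.21 (Deligne invariant cycle theorem: the invariant subalgebra is the image of the ambient classes)]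
* because: Gromov–Witten invariants are deformation invariant in smooth projective families (virtual fundamental class, [cite: LiTian1998, Thm. (deformation invariance)]), so parallel transport along a loop is an automorphism of the small and big quantum products of the fibre — GLLX Prop. 3.20 [cite: GalkinLeungLiXiong2025, Prop. 3.20], after [cite: Hu2015, §(monodromy method)]; restrictions of ambient classes are monodromy invariant (Deligne; tree theorem `Literature.AlgebraicGeometry.Motives.GeometricVHSData.monodromyRep_restrict`); the present theorem then propagates invariance to everything generated. On Hodge–Tate hyperplane sections `Y` of coadjoint `G/P` of type `D`/`E` the monodromy of the universal family acts on `H^*(Y) = H_inv ⊕ H_std` through the reflection representation of the Weyl group [cite: GalkinLeungLiXiong2025, Lemma 4.3], every invariant operator is scalar on the irreducible `H_std` (Schur), and the `W`-invariant symmetric cubic GW form vanishes on `H_std` since `(Sym³ 𝔥_std)^W = 0` outside type `A` (Chevalley degrees `d₁ = 2 < 4 ≤ d₂`) [cite: GalkinLeungLiXiong2025, Lemma 4.4 and proof of Thm. 4.5]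
* evasions_known: none published against this use; outside the class by construction: GW invariants with NON-invariant insertions / big quantum products at non-invariant parameters `τ` (equivariance then moves `τ`), and correspondences that are not deformation invariant over the family (e.g. cycles existing only on the special fibre — which is exactly what a proof of algebraicity of a special class must produce)
* scope_caveats: the Lean theorem is the abstract algebraic propagation statement; the geometric input "monodromy preserves the (small and big) quantum product" (Prop. 3.20, printed for the quantum product `QH^*` of the fibres of a projective smooth morphism, attributed to Li–Tian and Hu without a pinpointed theorem number) is QUOTED, not formalised — the tree has no Gromov–Witten invariants or quantum cohomology; likewise Lemma 4.3/4.4/Thm. 4.5 are quoted only. Nothing here restricts honest algebraic-cycle constructions on a fixed variety; the barrier concerns only classes produced uniformly (deformation-invariantly) from invariant seeds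
* status: established -/
theorem isFixed_of_mem_seedGenerated (ρ : Representation R G A) {m : T → A →ₗ[R] A →ₗ[R] A}
    (hm : ∀ (g : G) (t : T) (a b : A), ρ g (m t a b) = m t (ρ g a) (ρ g b))
    {seeds : Set A} (hseeds : ∀ g : G, ∀ s ∈ seeds, ρ g s = s) {a : A}
    (ha : a ∈ seedGenerated m seeds) (g : G) :
    ρ g a = a :=
  (seedGenerated_le (N := fixedSubmodule ρ) (fun s hs g => hseeds g s hs)
    (isClosedUnderOps_fixedSubmodule hm)) ha g

/-- Reformulation: under the hypotheses of the barrier the whole seed-generated submodule lies in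
the fixed submodule of the action. [cite: GalkinLeungLiXiong2025, Prop. 3.20] -/
theorem seedGenerated_le_fixedSubmodule (ρ : Representation R G A) {m : T → A →ₗ[R] A →ₗ[R] A}
    (hm : ∀ (g : G) (t : T) (a b : A), ρ g (m t a b) = m t (ρ g a) (ρ g b))
    {seeds : Set A} (hseeds : ∀ g : G, ∀ s ∈ seeds, ρ g s = s) :
    seedGenerated m seeds ≤ fixedSubmodule ρ :=
  fun _ ha g => isFixed_of_mem_seedGenerated ρ hm hseeds ha g

/-- **Corollary (the "regular element" criterion sees only invariant classes)**: if a vector `v` is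
NOT fixed by some `g ∈ G` (a Noether–Lefschetz-special direction: e.g. a vanishing class `β` with
`σ β = -β`, GLLX Lemma 3.21), then `v` is not generated from invariant seeds by equivariant
operations. [cite: GalkinLeungLiXiong2025, Lemma 3.21 and Prop. 3.20] -/
theorem not_mem_seedGenerated_of_ne (ρ : Representation R G A) {m : T → A →ₗ[R] A →ₗ[R] A}
    (hm : ∀ (g : G) (t : T) (a b : A), ρ g (m t a b) = m t (ρ g a) (ρ g b))
    {seeds : Set A} (hseeds : ∀ g : G, ∀ s ∈ seeds, ρ g s = s) {v : A} {g : G} (hv : ρ g v ≠ v) :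
    v ∉ seedGenerated m seeds :=
  fun hmem => hv (isFixed_of_mem_seedGenerated ρ hm hseeds hmem g)

end HodgeConjecture
end Barriers

end Literature.Barriers.HodgeConjecture
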